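import Summits.MatrixMultiplication.OmegaCensus.STPP222PowRoutes

/-!
# ω-census, `N₈` assembly: the route checker `covered8` (TSF supplies up to size 8) and its soundness

HONEST FRAMING (pub-omega census; verbatim): lottery ticket; floor = certified bounds/negative ranges.
Census STRUCTURE bookkeeping (question Q7 of the pub-omega cell: the uniform threshold `N₈`), not progress on `ω`: a `(2,2,2)⁸` family
certifies no matrix-multiplication bound of interest.

The generic checker `NkRoutes.coveredG` of `STPP222PowRoutes.lean` extracts tricolored-sum-free sets of size `≤ 7` from one cyclic
coordinate; for `k = 8` the `a = 1` route needs size `8`.  This file is its copy with `tsfCyc8` — **`ℤ/e ⊇` a TSF set of size `8` for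
`e ≥ 25`**: NEW kernel instances `ℤ/25, ℤ/26 → 8` (seat's exhaustive searcher `tsf.c`; `ℤ/23 ↛ 8` complete, `ℤ/24` undecided — seat
computations, not kernel statements) and the midpoint-free set `{0,1,3,4,9,10,12,13}` for `e ≥ 27` — reusing `hostG`, `hostP`, `needG`,
`tablesG` and the block lemmas of `NkRoutes`.  `covered8_sound`: shapes hosting `(2,2,2)^k` and `covered8 shapes k` on the moduli of a block give
`(2,2,2)^k ⊆ Π j, ℤ/q j`.  Consumer: `STPP222Pow8From530*.lean` (`N₈ ≤ 530`).  Exact Python mirror: `modelG8.py` (HOME `pub-omega-stpp-3-g11/code/`).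

References: H. Cohn, R. Kleinberg, B. Szegedy, C. Umans, FOCS 2005 (arXiv:math/0511460), Def. 5.1; J. Blasiak et al., Discrete
Analysis 2017:3, Def. 3.1.  Seat pub-omega-stpp-3 (gen 11), 2026-08-25.
-/

open Literature.Computability.AlgebraicComplexity Literature.Combinatorics.Additive Finset

namespace Summit.MatrixMultiplication.OmegaCensus

namespace N8Routes

open N5Kit N5From94 N6From290 NkRoutes

/-! ## 1. Tricolored sum-free sets of size 8 in cyclic groups -/

/-- The TSF size extracted from `ℤ/e`: `8` for `e ≥ 25`, else `tsfCycG e`. -/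
def tsfCyc8 (e : ℕ) : ℕ := if 25 ≤ e then 8 else tsfCycG e

/-- **`ℤ/e` carries a tricolored sum-free set of size `tsfCyc8 e`**: kernel instances `ℤ/25, ℤ/26 → 8` (seat search), the midpoint-free set
`{0,1,3,4,9,10,12,13}` for `e ≥ 27`, and `hasTSF_zmod_tsfCycG` below `25`. [cite: BlasiakChurchCohnGrochowNaslundSawinUmans2017, Def. 3.1] -/
theorem hasTSF_zmod_tsfCyc8 (e : ℕ) : HasTSF (ZMod e) (tsfCyc8 e) := by
  unfold tsfCyc8
  by_cases h25 : 25 ≤ e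
  · rw [if_pos h25]
    by_cases h27 : 27 ≤ e
    · exact hasTSF_zmod_of_midpointFree ![0, 1, 3, 4, 9, 10, 12, 13] (by decide) (fun i => by fin_cases i <;> simp <;> omega)
    interval_cases e
    · exact ⟨![0, 1, 3, 5, 8, 10, 12, 13], ![0, 1, 4, 18, 16, 5, 8, 9], ![0, 23, 18, 2, 1, 10, 5, 3],
        by unfold IsTricoloredSumFree; decide⟩
    · exact ⟨![0, 1, 3, 4, 14, 20, 22, 24], ![0, 1, 3, 7, 21, 19, 16, 20], ![0, 24, 20, 15, 17, 13, 14, 8],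
        by unfold IsTricoloredSumFree; decide⟩
  · rw [if_neg h25]
    exact hasTSF_zmod_tsfCycG e

/-! ## 2. The Boolean route checker -/

/-- Base TSF supplies of a block with moduli `B`, size `≥ t` (as `NkRoutes.tsfBaseG`, with `tsfCyc8`). -/
def tsfBase8 (t : ℕ) (B : Multiset ℕ) : Bool :=
  decide (t ≤ 1) || anyM B (fun x => decide (t ≤ tsfCyc8 x)) ||
    anyM B (fun x => anyM (B.erase x) (fun y => decide (Nat.Coprime x y ∧ t ≤ tsfCyc8 (x * y)))) ||
    tablesG.any (fun st => decide (t ≤ st.2) && dom st.1 B)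

/-- TSF supplies with `fuel` levels of splitting: the base supplies, or a split carrying the TSF graph (both parts of order `≥ t`) or a
product of TSF sets of sizes `(2, ⌈t/2⌉)` or `(3, ⌈t/3⌉)`. -/
def tsfGE8 : ℕ → ℕ → Multiset ℕ → Bool
  | 0, t, B => tsfBase8 t B
  | fuel + 1, t, B => tsfBase8 t B ||
      anyM B.powerset (fun B₂ => decide (t ≤ B₂.prod ∧ t ≤ (B - B₂).prod) ||
        (tsfGE8 fuel 2 B₂ && tsfGE8 fuel ((t + 1) / 2) (B - B₂)) || (tsfGE8 fuel 3 B₂ && tsfGE8 fuel ((t + 2) / 3) (B - B₂)))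

/-- **The route checker for `(2,2,2)^k` with seed shapes `shapes`**: (fast path) ONE modulus `x` as the TSF block (`tsfCyc8 x`) next to
the uniform law on the rest (order `M.prod / x`); or domination of a shape; or a split `M = A + B` with `hostG A ≠ 0` and a TSF set of
size `needG k (hostG A)` on `B`. -/
def covered8 (shapes : List (List ℕ)) (k : ℕ) (M : Multiset ℕ) : Bool :=
  anyM M (fun x => decide (hostP (M.prod / x) ≠ 0 ∧ k ≤ hostP (M.prod / x) * tsfCyc8 x)) ||
  shapes.any (fun s => dom s M) ||
    anyM M.powerset (fun B => decide (hostG (M - B) ≠ 0) && tsfGE8 (Multiset.card M) (needG k (hostG (M - B))) B)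

/-! ## 3. Soundness -/

variable {ι : Type} [Fintype ι] [DecidableEq ι] {q : ι → ℕ}

omit [Fintype ι] in
/-- From ONE coordinate `i ∈ S`: `ℤ/q i ⊇` a TSF set of size `tsfCyc8 (q i)`. -/
theorem tsfOn_single8 (S : Finset ι) {i : ι} (hi : i ∈ S) {t : ℕ} (ht : t ≤ tsfCyc8 (q i)) : TSFOn q S t := by
  refine ⟨ZMod (q i), inferInstance, AddMonoidHom.single (fun j => ZMod (q j)) i,
    Pi.single_injective (M := fun j => ZMod (q j)) i, ?_, hasTSF_mono ht (hasTSF_zmod_tsfCyc8 (q i))⟩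
  intro x j hj
  have hji : j ≠ i := fun h => hj (h ▸ hi)
  simp [Pi.single_eq_of_ne hji]

omit [Fintype ι] in
/-- From a COPRIME PAIR of coordinates: `ℤ/(q i q i') ⊇` a TSF set of size `tsfCyc8 (q i q i')`. -/
theorem tsfOn_pair8 (S : Finset ι) {i i' : ι} (hi : i ∈ S) (hi' : i' ∈ S) (hcop : Nat.Coprime (q i) (q i')) {t : ℕ}
    (ht : t ≤ tsfCyc8 (q i * q i')) : TSFOn q S t := by
  set c : Π j, ZMod (q j) := Pi.single i 1 + Pi.single i' 1 with hcdef
  have ho1 : addOrderOf (Pi.single i (1 : ZMod (q i)) : Π j, ZMod (q j)) = q i := by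
    rw [← AddMonoidHom.single_apply, addOrderOf_injective _ (Pi.single_injective (M := fun j => ZMod (q j)) i),
      ZMod.addOrderOf_one]
  have ho2 : addOrderOf (Pi.single i' (1 : ZMod (q i')) : Π j, ZMod (q j)) = q i' := by
    rw [← AddMonoidHom.single_apply, addOrderOf_injective _ (Pi.single_injective (M := fun j => ZMod (q j)) i'),
      ZMod.addOrderOf_one]
  have hord : addOrderOf c = q i * q i' := by
    rw [hcdef, AddCommute.addOrderOf_add_eq_mul_addOrderOf_of_coprime (AddCommute.all _ _) (by rwa [ho1, ho2]), ho1, ho2]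
  have hsupp : ∀ j ∉ S, c j = 0 := by
    intro j hj
    have h1 : j ≠ i := fun h => hj (h ▸ hi)
    have h2 : j ≠ i' := fun h => hj (h ▸ hi')
    simp [hcdef, Pi.single_eq_of_ne h1, Pi.single_eq_of_ne h2]
  obtain ⟨φ, hφ, hφs⟩ := exists_emb_of_elem S c hsupp hord
  exact ⟨_, inferInstance, φ, hφ, hφs, hasTSF_mono ht (hasTSF_zmod_tsfCyc8 _)⟩

omit [Fintype ι] in
/-- Soundness of the base supplies. -/
theorem tsfBase8_sound (hq : ∀ i, 0 < q i) {t : ℕ} (S : Finset ι) (h : tsfBase8 t (S.val.map q) = true) : TSFOn q S t := by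
  simp only [tsfBase8, Bool.or_eq_true, Bool.and_eq_true, decide_eq_true_eq, anyM_iff, List.any_eq_true] at h
  rcases h with ((h1 | ⟨x, hx, hxt⟩) | ⟨x, hx, y, hy, hcop, hyt⟩) | ⟨st, hst, hle, hdom⟩
  · exact tsfOn_of_le_one S h1
  · obtain ⟨i, hi, rfl⟩ := Multiset.mem_map.1 hx
    exact tsfOn_single8 S hi hxt
  · obtain ⟨i, hi, rfl⟩ := Multiset.mem_map.1 hx
    obtain ⟨i', hi', rfl⟩ := Multiset.mem_map.1 (Multiset.mem_of_mem_erase hy)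
    exact tsfOn_pair8 S hi hi' hcop hyt
  · exact (tsfOn_of_dom hq S hdom (hasTSF_tablesG st hst)).mono (Subset.refl _) hle

/-- Soundness of `tsfGE8`. -/
theorem tsfGE8_sound (hq : ∀ i, 0 < q i) : ∀ (fuel t : ℕ) (S : Finset ι), tsfGE8 fuel t (S.val.map q) = true → TSFOn q S t
  | 0, _, S, h => tsfBase8_sound hq S h
  | fuel + 1, t, S, h => by
      rw [tsfGE8, Bool.or_eq_true] at h
      rcases h with h | h
      · exact tsfBase8_sound hq S h
      rw [anyM_iff] at h
      obtain ⟨B₂, hB₂, h⟩ := h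
      rw [Multiset.mem_powerset] at hB₂
      obtain ⟨T, hTS, hT⟩ := exists_subset_map_eq q S B₂ hB₂
      have hdiff : S.val.map q - B₂ = (S \ T).val.map q := by rw [← hT, map_val_sdiff q hTS]
      have hun : T ∪ S \ T = S := Finset.union_sdiff_of_subset hTS
      rw [hdiff, ← hT, Bool.or_eq_true, Bool.or_eq_true, decide_eq_true_eq, Bool.and_eq_true, Bool.and_eq_true] at h
      rw [← hun]
      rcases h with (⟨h2, h3⟩ | ⟨h2, h3⟩) | ⟨h2, h3⟩
      · exact tsfOn_graph hq Finset.disjoint_sdiff h2 h3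
      · exact (tsfOn_mul Finset.disjoint_sdiff (tsfGE8_sound hq fuel 2 T h2) (tsfGE8_sound hq fuel _ (S \ T) h3)).mono
          (Subset.refl _) (by omega)
      · exact (tsfOn_mul Finset.disjoint_sdiff (tsfGE8_sound hq fuel 3 T h2) (tsfGE8_sound hq fuel _ (S \ T) h3)).mono
          (Subset.refl _) (by omega)

/-- **Soundness of the generic route checker**: if every shape hosts `(2,2,2)^k` and the multiset of moduli of a block `S` passes
`covered8 shapes k`, then `(2,2,2)^k ⊆ Π j, ℤ/q j`. [cite: CohnKleinbergSzegedyUmans2005, Def. 5.1] -/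
theorem covered8_sound {shapes : List (List ℕ)} {k : ℕ} (hshapes : ∀ s ∈ shapes, HasPow (SeedType s) k) (hq : ∀ i, 0 < q i)
    (S : Finset ι) (h : covered8 shapes k (S.val.map q) = true) : HasPow (Π j, ZMod (q j)) k := by
  simp only [covered8, Bool.or_eq_true, Bool.and_eq_true, decide_eq_true_eq, anyM_iff, List.any_eq_true] at h
  rcases h with (⟨x, hx, hh0, hk⟩ | ⟨s, hs, hdom⟩) | ⟨B, hB, hhost, htsf⟩
  · -- fast path: the TSF block is the single coordinate `i`, the law block is `S \ {i}`
    obtain ⟨i, hi, rfl⟩ := Multiset.mem_map.1 hx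
    have hsub : ({i} : Finset ι) ⊆ S := Finset.singleton_subset_iff.2 hi
    have hrest : (S.val.map q).prod / q i = ((S \ {i}).val.map q).prod := by
      have hmul : (S.val.map q).prod = q i * ((S \ {i}).val.map q).prod := by
        rw [map_val_sdiff q hsub, ← Multiset.prod_erase hx]
        congr 1
        simp
      rw [hmul, Nat.mul_div_cancel_left _ (hq i)]
    rw [hrest] at hh0 hk
    exact hasPow_of_parts_le Finset.sdiff_disjoint (stppOn_hostP hq _ hh0)
      (tsfOn_single8 {i} (Finset.mem_singleton_self i) le_rfl) hk
  · exact hasPow_of_dom hq S hdom (hshapes s hs)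
  · rw [Multiset.mem_powerset] at hB
    obtain ⟨T, hTS, hT⟩ := exists_subset_map_eq q S B hB
    have hdiff : S.val.map q - B = (S \ T).val.map q := by rw [← hT, map_val_sdiff q hTS]
    rw [hdiff] at hhost htsf
    rw [← hT] at htsf
    exact hasPow_of_parts_le Finset.sdiff_disjoint (stppOn_hostG hq (S \ T) hhost) (tsfGE8_sound hq _ _ T htsf)
      (le_mul_needG k hhost (hostG_le _))

end N8Routes

end Summit.MatrixMultiplication.OmegaCensus
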